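import Literature.AlgebraicTopology.SingularHomology.LocallyFlatComplement
import Literature.AlgebraicTopology.SingularHomology.LocalHomologyGeneration
import Literature.AlgebraicTopology.SingularHomology.SphereHomology
import HarnessLib

/-!
# The critical degree of the local homology at a locally flat closed subset, I: the local model

C. Voisin, *Hodge Theory and Complex Algebraic Geometry I* (CUP 2002), §11.1.2, proof of Lemma 11.13:
for a closed complex submanifold `Y ⊂ X` of codimension `k`, "the Thom isomorphism
`Hʲ(X, X − Y) ≅ H^{j−2k}(Y)`" of a tubular neighbourhood gives `Hʲ(X, X − Y) = 0` for `j < 2k` AND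
identifies the critical group `H^{2k}(X, X − Y)` with `H⁰(Y)`. The tree proves the vanishing below the
critical degree for TOPOLOGICAL local flatness, in homology and without tubular neighbourhoods
(`SingularHomology/LocallyFlatComplement`: `Hq(X, X ∖ S) = 0` for `q < k` when the closed `S` is
straightened by charts `X ⇀ F × K`, `dim F ≥ k`). This file and its sequels
(`LocallyFlatCriticalDegreeCharts`, `LocallyFlatCriticalDegree`) treat the CRITICAL degree `k` in the
same setting, in the orientation-free form "for `S` connected, `H_k(X, X ∖ S; R)` is generated by one
class" (a quotient of `R`: it is `R` when the normal structure has dimension exactly `k` and is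
`R`-orientable, and `0` or `R/2R`-like otherwise). Here: the local model (A. Hatcher, *Algebraic
Topology* (2002), §2.1 Thm. 2.16, Cor. 2.11; §2.2 Cor. 2.14).

* `relativeSingularHomology.bijective_δ_of_isZero` — `∂ : Hₙ₊₁(X, A) → Hₙ(A)` is bijective when
  `Hₙ₊₁(X) = 0 = Hₙ(X)`; `isIso_map_fst_of_contractibleSpace`, `isIso_map_prodMap_of_contractibleSpace`
  — products with contractible spaces; `exists_forall_mem_span_of_iso/…_of_surjective/…_of_isZero` —
  bookkeeping of "generated by one element";
* `homotopic_smul_id_ball_diff_zero`, `isIso_map_inclusion_ball_diff_zero` — concentric punctured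
  balls `B_F(0,r') ∖ 0 ⊆ B_F(0,r) ∖ 0` are homotopy equivalent (scaling);
* `exists_homeomorph_ball_diff_flat`, `nonempty_homologyBallDiffFlatIso`, `bijective_δ_ball` — for the
  ball `B = B((0,y),r)` of `F × K` (sup metric) and the flat piece `L = {p | p.1 = 0}`:
  `B ∖ L ≅ (B_F(0,r) ∖ 0) × B_K(y,r)`, `H_i(B ∖ L) ≅ H_i(ℝⁿ ∖ 0)` (`n = dim F`), and
  `∂ : H_{i+1}(B, B ∖ L) ≅ H_i(B ∖ L)` for `i ≥ 1`;
* `exists_forall_mem_span_localHomologyOfSet_ball` — **`H_k(B | L; R)` is generated by one class**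
  for `2 ≤ k ≤ n` (`≅ H_{k-1}(ℝⁿ ∖ 0; R)`: `R` for `k = n`, the tree's `homologyPuncturedIso`, and `0`
  for `k < n`);
* `surjective_inclMap_ball` — **nested model balls** `B((0,y''),r'') ⊆ B((0,y),r)`, `r'' ≤ r`, induce
  a surjection `H_k(B'' | L) → H_k(B | L)` (naturality of `∂`; the inclusion of the complements is a
  product of a contractible factor with concentric punctured balls).

Everything is proved; no definitions, no named facts.

## References

* [VoisinHodgeI2002] C. Voisin, Hodge Theory and Complex Algebraic Geometry I, CUP 2002, §11.1.2
  Lemma 11.13 (proof).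
* [HatcherAT2002] A. Hatcher, Algebraic Topology, CUP 2002, Ch. 0 (homotopy equivalences), §2.1
  Thm. 2.16 and Cor. 2.11, §2.2 Cor. 2.14 and Ex. 2.17.
-/

noncomputable section

open CategoryTheory Limits Set TopologicalSpace Metric

universe u v

namespace Literature.AlgebraicTopology.SingularHomology

variable (R : Type v) [CommRing R] (M : Type v) [AddCommGroup M] [Module R M]

/-! ### Generalities -/

section Generalities

variable {X : Type u} [TopologicalSpace X] {A B C : Type u} [TopologicalSpace A]
  [TopologicalSpace B] [TopologicalSpace C]

/-- **The connecting map `∂ : Hₙ₊₁(X, A) → Hₙ(A)` is bijective when `Hₙ₊₁(X) = 0 = Hₙ(X)`**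
(exactness of `Hₙ₊₁(X) → Hₙ₊₁(X, A) → Hₙ(A) → Hₙ(X)`, Hatcher 2002, §2.1 Thm. 2.13 ff.; e.g. for
`X` contractible and `n ≥ 1`). [cite: HatcherAT2002, §2.1 Thm. 2.16 and Ex. 2.18] -/
theorem relativeSingularHomology.bijective_δ_of_isZero (S : Set X) (n : ℕ)
    (h₁ : IsZero (singularHomology R M X (n + 1))) (h₀ : IsZero (singularHomology R M X n)) :
    Function.Bijective (relativeSingularHomology.δ R M X S n) := by
  haveI := ModuleCat.subsingleton_of_isZero h₁
  haveI := ModuleCat.subsingleton_of_isZero h₀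
  refine ⟨fun a b hab ↦ ?_, fun y ↦ ?_⟩
  · obtain ⟨x, hx⟩ := ((ShortComplex.moduleCat_exact_iff _).1
      (relativeSingularHomology.exact_ofAbsolute_δ R M (X := X) S n)) (a - b)
      (by change relativeSingularHomology.δ R M X S n (a - b) = 0; rw [map_sub, hab, sub_self])
    rw [← sub_eq_zero]
    change _ = a - b at hx
    rw [← hx, Subsingleton.elim x 0, map_zero]
  · obtain ⟨x, hx⟩ := ((ShortComplex.moduleCat_exact_iff _).1
      (relativeSingularHomology.exact_δ_map R M (X := X) S n)) y (Subsingleton.elim _ _)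
    exact ⟨x, hx⟩

/-- **`(A × C → A)_*` is an isomorphism for `C` contractible**: the projection is a homotopy
equivalence with inverse `a ↦ (a, c₀)` (Hatcher 2002, Ch. 0). [cite: HatcherAT2002, Ch. 0 (homotopy equivalence) and §2.1 Cor. 2.11] -/
theorem isIso_map_fst_of_contractibleSpace [ContractibleSpace C] (j : ℕ) :
    IsIso (singularHomology.map R M (ContinuousMap.fst : C(A × C, A)) j) := by
  obtain ⟨c₀, hc₀⟩ := (contractible_iff_id_nullhomotopic C).1 inferInstance
  have h1 : ((ContinuousMap.id A).prodMk (ContinuousMap.const A c₀)).comp ContinuousMap.fst =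
      (ContinuousMap.id A).prodMap (ContinuousMap.const C c₀) := by
    ext x <;> rfl
  have h2 : (ContinuousMap.id (A × C)) = (ContinuousMap.id A).prodMap (ContinuousMap.id C) := by
    ext x <;> rfl
  let e : ContinuousMap.HomotopyEquiv (A × C) A :=
    { toFun := ContinuousMap.fst
      invFun := (ContinuousMap.id A).prodMk (ContinuousMap.const A c₀)
      left_inv := by
        rw [h1, h2]
        exact ContinuousMap.Homotopic.prodMap (ContinuousMap.Homotopic.refl _) hc₀.symm
      right_inv := ContinuousMap.Homotopic.refl _ }
  exact (singularHomology.isoOfHomotopyEquiv R M e j).isIso_hom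

/-- If `f_* : H_j(A) → H_j(B)` is an isomorphism and `C`, `C'` are contractible, then
`(f × g)_* : H_j(A × C) → H_j(B × C')` is an isomorphism for every `g : C → C'` (compare the two
projections, `isIso_map_fst_of_contractibleSpace`). [cite: HatcherAT2002, §2.1 Cor. 2.11] -/
theorem isIso_map_prodMap_of_contractibleSpace {C' : Type u} [TopologicalSpace C']
    [ContractibleSpace C] [ContractibleSpace C'] (f : C(A, B)) (g : C(C, C')) (j : ℕ)
    [IsIso (singularHomology.map R M f j)] :
    IsIso (singularHomology.map R M (f.prodMap g) j) := by
  have hsq : singularHomology.map R M (f.prodMap g) j ≫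
      singularHomology.map R M (ContinuousMap.fst : C(B × C', B)) j =
      singularHomology.map R M (ContinuousMap.fst : C(A × C, A)) j ≫ singularHomology.map R M f j := by
    rw [← singularHomology.map_comp, ← singularHomology.map_comp]
    rfl
  haveI := isIso_map_fst_of_contractibleSpace R M (A := B) (C := C') j
  haveI := isIso_map_fst_of_contractibleSpace R M (A := A) (C := C) j
  haveI : IsIso (singularHomology.map R M (f.prodMap g) j ≫
      singularHomology.map R M (ContinuousMap.fst : C(B × C', B)) j) := by
    rw [hsq]
    infer_instance
  exact IsIso.of_isIso_comp_right (singularHomology.map R M (f.prodMap g) j)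
    (singularHomology.map R M (ContinuousMap.fst : C(B × C', B)) j)

/-- Isomorphism invariance of being generated by one element. [folklore] -/
theorem exists_forall_mem_span_of_iso {V W : ModuleCat.{v} R} (e : V ≅ W)
    (h : ∃ θ : V, ∀ y : V, y ∈ Submodule.span R ({θ} : Set V)) :
    ∃ θ : W, ∀ y : W, y ∈ Submodule.span R ({θ} : Set W) := by
  obtain ⟨θ, hθ⟩ := h
  refine ⟨e.hom θ, fun y ↦ ?_⟩
  have hy : e.inv y ∈ Submodule.span R ({θ} : Set V) := hθ _
  have := Submodule.mem_map_of_mem (f := e.hom.hom) hy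
  rw [Submodule.map_span, Set.image_singleton] at this
  simpa using this

/-- A surjection carries a generator to a generator. [folklore] -/
theorem exists_forall_mem_span_of_surjective {V W : ModuleCat.{v} R} (f : V ⟶ W)
    (hf : Function.Surjective f) (h : ∃ θ : V, ∀ y : V, y ∈ Submodule.span R ({θ} : Set V)) :
    ∃ θ : W, ∀ y : W, y ∈ Submodule.span R ({θ} : Set W) := by
  obtain ⟨θ, hθ⟩ := h
  refine ⟨f θ, fun y ↦ ?_⟩
  obtain ⟨x, rfl⟩ := hf y
  have := Submodule.mem_map_of_mem (f := f.hom) (hθ x)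
  rw [Submodule.map_span, Set.image_singleton] at this
  exact this

/-- The zero module is generated by `0`. [folklore] -/
theorem exists_forall_mem_span_of_isZero {V : ModuleCat.{v} R} (h : IsZero V) :
    ∃ θ : V, ∀ y : V, y ∈ Submodule.span R ({θ} : Set V) := by
  haveI := ModuleCat.subsingleton_of_isZero h
  exact ⟨0, fun y ↦ by rw [Subsingleton.elim y 0]; exact Submodule.zero_mem _⟩

end Generalities

/-! ### Punctured balls: concentric inclusions are homotopy equivalences -/

section PuncturedBall

variable {F : Type} [NormedAddCommGroup F] [NormedSpace ℝ F]

/-- Scaling by a factor `a ∈ (0, 1]` preserves a punctured ball centred at `0`. [folklore] -/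
theorem smul_mem_ball_diff_zero {ρ a : ℝ} (ha0 : 0 < a) (ha1 : a ≤ 1) {v : F}
    (hv : v ∈ ball (0 : F) ρ \ {0}) : a • v ∈ ball (0 : F) ρ \ {0} := by
  refine ⟨?_, ?_⟩
  · have h := hv.1
    rw [mem_ball_zero_iff] at h ⊢
    rw [norm_smul, Real.norm_of_nonneg ha0.le]
    nlinarith [norm_nonneg v]
  · have h := hv.2
    simp only [mem_singleton_iff] at h ⊢
    exact smul_ne_zero ha0.ne' h

/-- On a punctured ball `B_F(0, ρ) ∖ 0`, the scaling `v ↦ c • v` by `c ∈ (0, 1]` is homotopic to the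
identity, through the scalings by `(1 - t) c + t ∈ [c, 1]`. [folklore] -/
theorem homotopic_smul_id_ball_diff_zero (ρ : ℝ) {c : ℝ} (hc0 : 0 < c) (hc1 : c ≤ 1) :
    ContinuousMap.Homotopic
      (⟨fun v ↦ ⟨c • v.1, smul_mem_ball_diff_zero hc0 hc1 v.2⟩, Continuous.subtype_mk (by fun_prop) _⟩ :
        C(↥(ball (0 : F) ρ \ {0}), ↥(ball (0 : F) ρ \ {0})))
      (ContinuousMap.id _) := by
  have hcoef : ∀ t : unitInterval, 0 < (1 - (t : ℝ)) * c + t ∧ (1 - (t : ℝ)) * c + t ≤ 1 := by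
    intro t
    have ht0 : 0 ≤ (t : ℝ) := t.2.1
    have ht1 : (t : ℝ) ≤ 1 := t.2.2
    have hl : c ≤ (1 - (t : ℝ)) * c + t := by nlinarith
    exact ⟨hc0.trans_le hl, by nlinarith⟩
  exact ⟨{ toFun := fun tv ↦ ⟨((1 - (tv.1 : ℝ)) * c + (tv.1 : ℝ)) • tv.2.1,
              smul_mem_ball_diff_zero (hcoef tv.1).1 (hcoef tv.1).2 tv.2.2⟩
           continuous_toFun := Continuous.subtype_mk (by fun_prop) _
           map_zero_left := fun v ↦ by ext; simp
           map_one_left := fun v ↦ by ext; simp }⟩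

/-- **Concentric punctured balls**: for `0 < r' ≤ r` the inclusion
`B_F(0, r') ∖ 0 ⊆ B_F(0, r) ∖ 0` induces isomorphisms on homology (it is a homotopy equivalence,
with homotopy inverse the scaling by `r'/r`). [cite: HatcherAT2002, §2.1 Cor. 2.11] -/
theorem isIso_map_inclusion_ball_diff_zero {r' r : ℝ} (hr' : 0 < r') (h : r' ≤ r) (j : ℕ) :
    IsIso (singularHomology.map R M (subsetInclusion
      (fun _ hv ↦ ⟨ball_subset_ball h hv.1, hv.2⟩ : ball (0 : F) r' \ {0} ⊆ ball (0 : F) r \ {0})) j) := by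
  have hr : 0 < r := hr'.trans_le h
  set c : ℝ := r' / r with hc
  have hc0 : 0 < c := div_pos hr' hr
  have hc1 : c ≤ 1 := (div_le_one hr).2 h
  -- the shrinking map `v ↦ c • v : B(0, r) ∖ 0 → B(0, r') ∖ 0`
  have hmem : ∀ v : ↥(ball (0 : F) r \ {0}), c • v.1 ∈ ball (0 : F) r' \ {0} := by
    intro v
    refine ⟨?_, ?_⟩
    · have hv := v.2.1
      rw [mem_ball_zero_iff] at hv ⊢
      rw [norm_smul, Real.norm_of_nonneg hc0.le, hc, div_mul_eq_mul_div, div_lt_iff₀ hr]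
      nlinarith [norm_nonneg v.1]
    · have hv := v.2.2
      simp only [mem_singleton_iff] at hv ⊢
      exact smul_ne_zero hc0.ne' hv
  let sh : C(↥(ball (0 : F) r \ {0}), ↥(ball (0 : F) r' \ {0})) :=
    ⟨fun v ↦ ⟨c • v.1, hmem v⟩, Continuous.subtype_mk (by fun_prop) _⟩
  let e : ContinuousMap.HomotopyEquiv ↥(ball (0 : F) r' \ {0}) ↥(ball (0 : F) r \ {0}) :=
    { toFun := subsetInclusion (fun _ hv ↦ ⟨ball_subset_ball h hv.1, hv.2⟩)
      invFun := sh
      left_inv := by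
        convert homotopic_smul_id_ball_diff_zero (F := F) r' hc0 hc1 using 1
        ext v
        rfl
      right_inv := by
        convert homotopic_smul_id_ball_diff_zero (F := F) r hc0 hc1 using 1
        ext v
        rfl }
  exact (singularHomology.isoOfHomotopyEquiv R M e j).isIso_hom

end PuncturedBall

/-! ### The local model in the critical degree: a ball of `F × K` minus the flat piece -/

section Model

variable {F K : Type} [NormedAddCommGroup F] [NormedSpace ℝ F] [FiniteDimensional ℝ F]
  [NormedAddCommGroup K] [NormedSpace ℝ K]

omit [NormedSpace ℝ F] [FiniteDimensional ℝ F] [NormedSpace ℝ K] in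
/-- **The flat piece seen from a ball `B((0, y), r)`**: `B ∖ {p | p.1 = 0} = (B_F(0,r) ∖ 0) × B_K(y, r)`,
as a homeomorphism from the complement of the trace inside `↥B` to the product of subtypes, which
is the identity on coordinates. [folklore] -/
theorem exists_homeomorph_ball_diff_flat (y : K) (r : ℝ) :
    ∃ φ : ↥((Subtype.val ⁻¹' {p : F × K | p.1 = 0} : Set ↥(ball ((0 : F), y) r))ᶜ) ≃ₜ
        ↥(ball (0 : F) r \ {0}) × ↥(ball y r),
      ∀ z, ((φ z).1 : F) = z.1.1.1 ∧ ((φ z).2 : K) = z.1.1.2 := by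
  let φ₁ : ↥((Subtype.val ⁻¹' {p : F × K | p.1 = 0} : Set ↥(ball ((0 : F), y) r))ᶜ) ≃ₜ
      ↥(ball ((0 : F), y) r \ {p : F × K | p.1 = 0}) :=
    { toFun := fun z ↦ ⟨z.1.1, z.1.2, z.2⟩
      invFun := fun p ↦ ⟨⟨p.1, p.2.1⟩, p.2.2⟩
      left_inv := fun _ ↦ rfl
      right_inv := fun _ ↦ rfl
      continuous_toFun := by fun_prop
      continuous_invFun := by fun_prop }
  exact ⟨φ₁.trans ((Homeomorph.setCongr (ball_diff_fst_eq_zero_eq_prod y r)).trans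
    (Homeomorph.Set.prod _ _)), fun _ ↦ ⟨rfl, rfl⟩⟩

/-- **The homology of the complement of the flat piece in a ball is that of `ℝⁿ ∖ 0`**, `n = dim F`:
`H_i((B_F(0,r) ∖ 0) × B_K(y,r)) ≅ H_i(B_F(0,r) ∖ 0) ≅ H_i(F ∖ 0) ≅ H_i(ℝⁿ ∖ 0)` (contractible second
factor; radial and linear homeomorphisms). [cite: HatcherAT2002, §2.2 Cor. 2.14 and Ex. 2.17] -/
theorem nonempty_homologyBallDiffFlatIso (y : K) {r : ℝ} (hr : 0 < r) (i : ℕ) :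
    Nonempty (singularHomology R M
        ↥((Subtype.val ⁻¹' {p : F × K | p.1 = 0} : Set ↥(ball ((0 : F), y) r))ᶜ) i ≅
      singularHomology R M ↥(punctured (Module.finrank ℝ F)) i) := by
  haveI : ContractibleSpace ↥(ball y r) := (convex_ball y r).contractibleSpace ⟨y, mem_ball_self hr⟩
  haveI := isIso_map_fst_of_contractibleSpace R M (A := ↥(ball (0 : F) r \ {0})) (C := ↥(ball y r)) i
  obtain ⟨φ, -⟩ := exists_homeomorph_ball_diff_flat (F := F) y r
  exact ⟨singularHomology.mapIso R M φ i ≪≫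
    asIso (singularHomology.map R M
      (ContinuousMap.fst : C(↥(ball (0 : F) r \ {0}) × ↥(ball y r), ↥(ball (0 : F) r \ {0}))) i) ≪≫
    singularHomology.mapIso R M (nonempty_homeomorph_ball_diff_zero (F := F) hr).some i ≪≫
    singularHomology.mapIso R M (nonempty_homeomorph_compl_zero_punctured (F := F)).some i⟩

omit [FiniteDimensional ℝ F] in
/-- **The connecting map of the model pair is bijective**: for the ball `B = B((0, y), r)` of
`F × K` and the flat piece `L = {p | p.1 = 0}`, `∂ : H_{i+1}(B, B ∖ L) → H_i(B ∖ L)` is bijective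
for `i ≥ 1` (`B` is convex). [cite: HatcherAT2002, §2.1 Thm. 2.16] -/
theorem bijective_δ_ball (y : K) {r : ℝ} (hr : 0 < r) {i : ℕ} (hi : 1 ≤ i) :
    Function.Bijective (relativeSingularHomology.δ R M ↥(ball ((0 : F), y) r)
      (Subtype.val ⁻¹' {p : F × K | p.1 = 0} : Set ↥(ball ((0 : F), y) r))ᶜ i) := by
  have hconv : Convex ℝ (ball ((0 : F), y) r) := convex_ball _ _
  haveI : ContractibleSpace ↥(ball ((0 : F), y) r) :=
    hconv.contractibleSpace ⟨((0 : F), y), mem_ball_self hr⟩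
  exact relativeSingularHomology.bijective_δ_of_isZero R M _ i
    (isZero_singularHomology_of_contractibleSpace R M (by omega))
    (isZero_singularHomology_of_contractibleSpace R M (by omega))

/-- **The model group is generated by one class**: for `2 ≤ k ≤ dim F`,
`H_k(B((0,y),r) | L; R) = H_k(B, B ∖ L; R)` is generated by one element — it is `≅ H_{k-1}(ℝⁿ ∖ 0; R)`,
which is `R` for `k = n` (Hatcher Cor. 2.14) and `0` for `k < n`. [cite: HatcherAT2002, §2.2 Cor. 2.14] -/
theorem exists_forall_mem_span_localHomologyOfSet_ball (y : K) {r : ℝ} (hr : 0 < r) {k : ℕ}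
    (hk2 : 2 ≤ k) (hk : k ≤ Module.finrank ℝ F) :
    ∃ θ : localHomologyOfSet R R ↥(ball ((0 : F), y) r) (Subtype.val ⁻¹' {p : F × K | p.1 = 0}) k,
      ∀ x, x ∈ Submodule.span R ({θ} : Set _) := by
  obtain ⟨i, rfl⟩ : ∃ i, k = i + 1 := ⟨k - 1, by omega⟩
  -- `∂ : H_{i+1}(B | L) ≅ H_i(B ∖ L) ≅ H_i(ℝⁿ ∖ 0)`
  have hδ := bijective_δ_ball R R (F := F) (K := K) y hr (i := i) (by omega)
  let eδ := (LinearEquiv.ofBijective (relativeSingularHomology.δ R R ↥(ball ((0 : F), y) r)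
      (Subtype.val ⁻¹' {p : F × K | p.1 = 0} : Set ↥(ball ((0 : F), y) r))ᶜ i).hom hδ).toModuleIso
  refine exists_forall_mem_span_of_iso R (eδ ≪≫ (nonempty_homologyBallDiffFlatIso R R y hr i).some).symm ?_
  by_cases hin : i + 1 = Module.finrank ℝ F
  · -- `k = n`: `H_{n-1}(ℝⁿ ∖ 0; R) ≅ R`, generated by `1`
    have e₁ : singularHomology R R ↥(punctured (Module.finrank ℝ F)) i ≅ ModuleCat.of R R := by
      rw [← hin]
      exact (csingularHomology.compIso R R _ i).symm ≪≫ homologyPuncturedIso R R i (by omega)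
    refine exists_forall_mem_span_of_iso R e₁.symm ⟨(1 : R), fun x ↦ ?_⟩
    exact Submodule.mem_span_singleton.2 ⟨x, by simp⟩
  · -- `k < n`: the group vanishes
    exact exists_forall_mem_span_of_isZero R
      ((isZero_homology_punctured_of_succ_ne R R i (Module.finrank ℝ F) (by omega) hin).of_iso
        (csingularHomology.compIso R R _ i).symm)

omit [FiniteDimensional ℝ F] in
/-- **Nested model balls**: for balls `B'' = B((0, y''), r'') ⊆ B = B((0, y), r)` of `F × K`
centred on the flat piece `L`, with `0 < r'' ≤ r`, the map `H_k(B'' | L) → H_k(B | L)` induced by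
the inclusion is onto for `k ≥ 2` (both connecting maps are bijective and
`H_{k-1}(B'' ∖ L) → H_{k-1}(B ∖ L)` is an isomorphism: products of a contractible ball with
concentric punctured balls). [cite: HatcherAT2002, §2.1 Thm. 2.16 and Cor. 2.11] -/
theorem surjective_inclMap_ball {y'' y : K} {r'' r : ℝ} (hr'' : 0 < r'') (hrr : r'' ≤ r)
    (hsub : ball ((0 : F), y'') r'' ⊆ ball ((0 : F), y) r) {k : ℕ} (hk2 : 2 ≤ k) :
    Function.Surjective (localHomologyOfSet.inclMap R M (S := {p : F × K | p.1 = 0}) hsub k) := by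
  obtain ⟨i, rfl⟩ : ∃ i, k = i + 1 := ⟨k - 1, by omega⟩
  have hr : 0 < r := hr''.trans_le hrr
  set L : Set (F × K) := {p : F × K | p.1 = 0} with hL
  -- the two connecting maps
  have hδ'' := bijective_δ_ball R M (F := F) (K := K) y'' hr'' (i := i) (by omega)
  have hδ := bijective_δ_ball R M (F := F) (K := K) y hr (i := i) (by omega)
  -- naturality of `∂` along the inclusion of pairs
  have hnat := relativeSingularHomology.δ_naturality R M
    (subsetInclusion hsub) (relOpenMV.mapsTo_inclusion_compl hsub L) i
  -- the restriction of the inclusion to the complements is a homology isomorphism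
  have hK : ball y'' r'' ⊆ ball y r := fun w hw ↦ by
    have h := hsub (show ((0 : F), w) ∈ ball ((0 : F), y'') r'' from by
      rw [← ball_prod_same]; exact ⟨mem_ball_self hr'', hw⟩)
    rw [← ball_prod_same] at h
    exact h.2
  haveI : ContractibleSpace ↥(ball y'' r'') :=
    (convex_ball y'' r'').contractibleSpace ⟨y'', mem_ball_self hr''⟩
  haveI : ContractibleSpace ↥(ball y r) := (convex_ball y r).contractibleSpace ⟨y, mem_ball_self hr⟩
  let fF : C(↥(ball (0 : F) r'' \ {0}), ↥(ball (0 : F) r \ {0})) :=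
    subsetInclusion (fun _ hv ↦ ⟨ball_subset_ball hrr hv.1, hv.2⟩)
  haveI : IsIso (singularHomology.map R M fF i) :=
    isIso_map_inclusion_ball_diff_zero R M (F := F) hr'' hrr i
  haveI hprod : IsIso (singularHomology.map R M (fF.prodMap (subsetInclusion hK)) i) :=
    isIso_map_prodMap_of_contractibleSpace R M fF (subsetInclusion hK) i
  obtain ⟨φ, hφ⟩ := exists_homeomorph_ball_diff_flat (F := F) y r
  obtain ⟨φ'', hφ''⟩ := exists_homeomorph_ball_diff_flat (F := F) y'' r''
  have hc : (φ : C(↥((Subtype.val ⁻¹' L : Set ↥(ball ((0 : F), y) r))ᶜ), ↥(ball (0 : F) r \ {0}) × ↥(ball y r))).comp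
      (subsetRestrict (subsetInclusion hsub) (relOpenMV.mapsTo_inclusion_compl hsub L)) =
      (fF.prodMap (subsetInclusion hK)).comp
      (φ'' : C(↥((Subtype.val ⁻¹' L : Set ↥(ball ((0 : F), y'') r''))ᶜ),
          ↥(ball (0 : F) r'' \ {0}) × ↥(ball y'' r''))) := by
    refine ContinuousMap.ext fun z ↦ Prod.ext (Subtype.ext ?_) (Subtype.ext ?_)
    · change ((φ _).1 : F) = ((φ'' z).1 : F)
      rw [(hφ _).1, (hφ'' z).1]
      rfl
    · change ((φ _).2 : K) = ((φ'' z).2 : K)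
      rw [(hφ _).2, (hφ'' z).2]
      rfl
  have hright : Function.Surjective (singularHomology.map R M
      (subsetRestrict (subsetInclusion hsub) (relOpenMV.mapsTo_inclusion_compl hsub L)) i) :=
    (surjective_map_iff_of_homeomorph R M _ _ _ _ hc i).2
      (ConcreteCategory.bijective_of_isIso
        (singularHomology.map R M (fF.prodMap (subsetInclusion hK)) i)).2
  -- chase
  intro x
  obtain ⟨z, hz⟩ := hright (relativeSingularHomology.δ R M _ _ i x)
  obtain ⟨w, rfl⟩ := hδ''.2 z
  refine ⟨w, hδ.1 ?_⟩
  rw [← hz, ← ModuleCat.comp_apply, ← hnat, ModuleCat.comp_apply]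

end Model

end Literature.AlgebraicTopology.SingularHomology

end
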